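import Literature.NumberTheory.EllipticCurves.EisensteinKroneckerNumbersClassSum
import Literature.NumberTheory.EllipticCurves.EisensteinNumbersPartialHeckeLTwist
import Literature.NumberTheory.EllipticCurves.EisensteinKroneckerNumbersClassSumTwist
import Literature.NumberTheory.EllipticCurves.DeShalit1987.LValueAtZeroImprimitive
import Literature.NumberTheory.GaloisRepresentations.HeckeCharacterGrossencharakterOfInfinityType
import HarnessLib

/-!
# The complex side of de Shalit II.4.14 (36) at the absolutely convergent weights, assembled in idelic
# currency: class sums of Eisenstein numbers = `(k−1)!·(period factor)·∏_{w∈T}(1 − η(w))·L(η, 0)`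

Topic `Literature/NumberTheory/EllipticCurves` (grouping sub-namespace `DeShalit1987`); theorems only, no
definition, no named fact, nothing about BSD. One-stop composition of the cell's complex-side files for the
(e)-assembler of `KatzDistributionsAtTwoPrint`:
`EisensteinNumbersPartialHeckeL` (II.3.5 (13), `j = 0`), `EisensteinKroneckerNumbersClassSum` (`k ≥ j + 3`),
`GaloisRepresentations/HeckeCharacterGrossencharakterOfInfinityType` (`φ((α)) = α` for the idelic `φ` of type
`(1,0)`), `GaloisRepresentations/HeckeLFunctionValueOfNegativeWeight` + `DeShalit1987/LValueAtZeroImprimitive`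
(`rayClassLSeries 𝔪 (η(ϖ_·)) 0 = removedEulerFactorsAtZero η T · hL.continuation 0`).

INPUT CURRENCY (all idelic / by name): an imaginary quadratic `K` (`[IsTotallyComplex K]`, `finrank ℚ K = 2`),
its infinite place `w₀` (so `σ := w₀.embedding : K →+* ℂ`), a Hecke character `φ` of infinity type `(1, 0)`
with module of definition `(Tl, el)` and `𝔪 := modulusIdeal Tl el ≠ (1)` of trivial unit index `w_𝔪 = 1`
(de Shalit II.1.4 (12): `φ((α)) = α`), a ray class character `χ` mod `𝔪` (ideal currency
`IsRayClassCharacter`; from a finite-order Hecke character by the tree's `isRayClassCharacter_of_isModulus`), a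
system of representatives `T` of the classes (`IsRayClassReps`), period `Ω ≠ 0`, the class lattices
`Λ_{L 𝔠} = Ω·σ(𝔪/𝔠)` (= `𝔠⁻¹𝔪Ω`), and the `L`-FUNCTION character `η` (de Shalit's `ε⁻¹`, the tree's `ε` of
`interpolationValue`): ANY Hecke character of exponent `σ' > 1` with values `η(ϖ_v) = χ(v)⁻¹·φ(ϖ_v)^{−k}`
(resp. `χ(v)⁻¹·N(v)^j·φ(ϖ_v)^{−(j+k)}`) at the primes `v ∤ 𝔪`, ramified only inside `Tl`, with an entire
continuation `hL` of `heckeLFunction η`.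

* ★★ `DeShalit1987.sum_eisensteinE_eq_removedEulerFactorsAtZero_mul_continuation` (`j = 0`, `k ≥ 3`):
  **`Σ_{𝔠∈T} χ̃(𝔠)⁻¹·φ̃(𝔠)^{−k}·E_k(Ω, L 𝔠) = (k−1)!·Ω^{−k}·removedEulerFactorsAtZero η Tl·hL.continuation 0`**;
* ★★ `DeShalit1987.sum_eisensteinKronecker_eq_removedEulerFactorsAtZero_mul_continuation` (`k ≥ j + 3`, with the
  area relation `A(L 𝔠) = N𝔠·A₀`, `A₀ ≠ 0`):
  **`Σ_{𝔠∈T} χ̃(𝔠)⁻¹·φ̃(𝔠)^{−(j+k)}·E_{−j,k}(Ω, L 𝔠) = (k−1)!·A₀^j·Ω̄^j·Ω^{−k}·removedEulerFactorsAtZero η Tl·hL.continuation 0`**.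

* (appended) ★★ `DeShalit1987.sum_twist_eisensteinE_eq_removedEulerFactorsAtZero_mul_continuation` — the 𝔞-TWISTED
  `j = 0` statement (composing -w5 g14's `sum_twist_eisensteinE_eq_rayClassLSeries_zero`):
  `Σ_𝔠 χ̃𝔠⁻¹·λ̃𝔠^{−k}·(N𝔞·E_k(Ω, L 𝔠) − E_k(Ω, L(𝔞𝔠))) = (k−1)!·Ω^{−k}·(N𝔞 − χ̃(𝔞)λ̃(𝔞)^k)·removedEulerFactorsAtZero η Tl·hL.continuation 0`.

* (appended) ★★ `DeShalit1987.sum_twist_eisensteinKronecker_eq_removedEulerFactorsAtZero_mul_continuation` — the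
  𝔞-TWISTED statement at GENERAL `j` (`k ≥ j + 3`; composing `sum_twist_eisensteinKronecker_eq_rayClassLSeries_zero`
  of `EisensteinKroneckerNumbersClassSumTwist.lean`): `Σ_𝔠 χ̃𝔠⁻¹·λ̃𝔠^{−(j+k)}·(N𝔞·E_{−j,k}(Ω, L 𝔠) − E_{−j,k}(Ω, L(𝔞𝔠)))
  = (k−1)!·A₀^j·Ω̄^j·Ω^{−k}·(N𝔞 − χ̃(𝔞)λ̃(𝔞)^{j+k})·removedEulerFactorsAtZero η Tl·hL.continuation 0`.

These are de Shalit II.4.14 (36)/(42) at `n = 0` on the complex side, up to the Gauss sum `G(ε)`, the factor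
`(1 − ε(𝔭)/p)` (both supplied by the `p`-adic side), the `(√d_K/2π)^j`-normalisation of `A₀` (II.2.1 (6),
`EisensteinNumbersArea`) and the 𝔞-twist `12(N𝔞 − ε(𝔞))` of the auxiliary ideal
(`EisensteinNumbersPartialHeckeLTwist`).

References: E. de Shalit (1987), II.3.5 (13) (p. 54), II.4.11 (29) (p. 65), II.4.12 (32) (p. 67), II.4.14
(36)–(42) (p. 71–73), II.4.16 (50) (p. 77) [deShalit1987].

Mathlib / tree search: composition only (`lean search 'removedEulerFactorsAtZero.*eisenstein'` — nothing).
-/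

noncomputable section

open scoped nonZeroDivisors Nat ComplexConjugate
open NumberField NumberField.InfinitePlace IsDedekindDomain Complex
open Literature.NumberTheory.LFunctions Literature.NumberTheory.GaloisRepresentations
open Literature.NumberTheory.GaloisRepresentations.HeckeCharacter

namespace Literature.NumberTheory.EllipticCurves.DeShalit1987

variable {K : Type} [Field K] [NumberField K] [IsTotallyComplex K]

/-- ★★ **Complex side of II.4.14 (36) at `j = 0`, `k ≥ 3`, idelic currency**: for `φ` of type `(1,0)` with
module of definition `(Tl, el)` (`𝔪 = modulusIdeal Tl el ≠ (1)`, `w_𝔪 = 1`), `χ` a ray class character mod `𝔪`,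
representatives `T`, class lattices `Λ_{L 𝔠} = Ω·σ(𝔪/𝔠)` (`σ = w₀.embedding`), and any `L`-function character `η`
of exponent `σ' > 1`, ramified inside `Tl`, with `η(ϖ_v) = χ(v)⁻¹φ(ϖ_v)^{−k}` off `𝔪`:
`Σ_{𝔠∈T} χ̃(𝔠)⁻¹·φ̃(𝔠)^{−k}·E_k(Ω, L 𝔠) = (k−1)!·Ω^{−k}·∏_{w∈Tl}(1 − η(w))·L(η, 0)` with `L(η, 0) := hL.continuation 0`.
[cite: deShalit1987, II.3.5 (13), II.4.12 (32), II.4.14 (36)] -/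
theorem sum_eisensteinE_eq_removedEulerFactorsAtZero_mul_continuation (h2 : Module.finrank ℚ K = 2)
    (w₀ : InfinitePlace K) {lam : HeckeCharacter K} {Tl : Finset (HeightOneSpectrum (𝓞 K))}
    {el : HeightOneSpectrum (𝓞 K) → ℕ} (hl : lam.HasInfinityType (fun _ ↦ 1) (fun _ ↦ 0))
    (hlmod : IsModulus lam Tl el) (h𝔪1 : modulusIdeal Tl el ≠ ⊤)
    (hw : ∀ u : (𝓞 K)ˣ, (u : 𝓞 K) - 1 ∈ modulusIdeal Tl el → u = 1)
    {χ : HeightOneSpectrum (𝓞 K) → ℂ} (hχ : IsRayClassCharacter (modulusIdeal Tl el) χ)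
    {T : Finset (Ideal (𝓞 K))} (hT : IsRayClassReps (modulusIdeal Tl el) T)
    {Ω : ℂ} (hΩ : Ω ≠ 0) (L : Ideal (𝓞 K) → PeriodPair)
    (hL : ∀ 𝔠 ∈ T, ∀ z : ℂ, z ∈ (L 𝔠).lattice ↔
      ∃ x ∈ ((modulusIdeal Tl el : FractionalIdeal (𝓞 K)⁰ K) / (𝔠 : FractionalIdeal (𝓞 K)⁰ K)),
        z = Ω * w₀.embedding x)
    {η : HeckeCharacter K} {σ' : ℝ} (hη : ∀ x : ideleGroup K, ‖((η x : ℂˣ) : ℂ)‖ = ideleNorm x ^ σ')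
    (h1 : 1 < σ') {k : ℕ}
    (hval : ∀ v : HeightOneSpectrum (𝓞 K), ¬ modulusIdeal Tl el ≤ v.asIdeal →
      η.valueAtUniformizer v = (χ v)⁻¹ * (lam.valueAtUniformizer v ^ k)⁻¹)
    (hram : ∀ v : HeightOneSpectrum (𝓞 K), ¬ η.IsUnramifiedAt v → v ∈ Tl)
    (hLη : LFunction.HasEntireContinuation (heckeLFunction η)) (hk : 3 ≤ k) :
    ∑ 𝔠 ∈ T, (idealPow K χ 𝔠)⁻¹ * (idealPow K (fun v ↦ lam.valueAtUniformizer v) 𝔠 ^ k)⁻¹ *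
        (L 𝔠).eisensteinE k Ω =
      ((k - 1)! : ℂ) * (Ω ^ k)⁻¹ * (removedEulerFactorsAtZero η Tl * hLη.continuation 0) := by
  have h𝔪0 : modulusIdeal Tl el ≠ ⊥ := modulusIdeal_ne_bot Tl el
  rw [sum_eisensteinE_eq_rayClassLSeries_zero h𝔪1 h𝔪0 hw (valueAtUniformizer_ne_zero_of_not_le lam _)
      (HasInfinityType.idealPow_span_mul_embedding_eq h2 w₀ hl hlmod) hχ hT hΩ L hL hk,
    ← rayClassLSeries_congr h𝔪0 hval 0,
    rayClassLSeries_zero_eq_removedEulerFactorsAtZero_mul_continuation_zero hη h1 h𝔪0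
      (fun _ ↦ modulusIdeal_le_iff) hram hLη]

/-- ★★ **Complex side of II.4.14 (36) for `E_{−j,k}`, `k ≥ j + 3`, idelic currency** (hypotheses as in the
`j = 0` version, plus the area relation `A(L 𝔠) = N𝔠·A₀`, `A₀ ≠ 0`, and `η(ϖ_v) = χ(v)⁻¹N(v)^jφ(ϖ_v)^{−(j+k)}`
off `𝔪` — de Shalit's `ε⁻¹` for `ε = φ^kφ̄^{−j}χ`):
`Σ_{𝔠∈T} χ̃(𝔠)⁻¹·φ̃(𝔠)^{−(j+k)}·E_{−j,k}(Ω, L 𝔠) = (k−1)!·A₀^j·Ω̄^j·Ω^{−k}·∏_{w∈Tl}(1 − η(w))·L(η, 0)`.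
[cite: deShalit1987, II.3.5 (13), II.4.12 (32), II.4.14 (36)–(42)] -/
theorem sum_eisensteinKronecker_eq_removedEulerFactorsAtZero_mul_continuation (h2 : Module.finrank ℚ K = 2)
    (w₀ : InfinitePlace K) {lam : HeckeCharacter K} {Tl : Finset (HeightOneSpectrum (𝓞 K))}
    {el : HeightOneSpectrum (𝓞 K) → ℕ} (hl : lam.HasInfinityType (fun _ ↦ 1) (fun _ ↦ 0))
    (hlmod : IsModulus lam Tl el) (h𝔪1 : modulusIdeal Tl el ≠ ⊤)
    (hw : ∀ u : (𝓞 K)ˣ, (u : 𝓞 K) - 1 ∈ modulusIdeal Tl el → u = 1)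
    {χ : HeightOneSpectrum (𝓞 K) → ℂ} (hχ : IsRayClassCharacter (modulusIdeal Tl el) χ)
    {T : Finset (Ideal (𝓞 K))} (hT : IsRayClassReps (modulusIdeal Tl el) T)
    {Ω : ℂ} (hΩ : Ω ≠ 0) (L : Ideal (𝓞 K) → PeriodPair)
    (hL : ∀ 𝔠 ∈ T, ∀ z : ℂ, z ∈ (L 𝔠).lattice ↔
      ∃ x ∈ ((modulusIdeal Tl el : FractionalIdeal (𝓞 K)⁰ K) / (𝔠 : FractionalIdeal (𝓞 K)⁰ K)),
        z = Ω * w₀.embedding x)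
    {A₀ : ℂ} (hA : ∀ 𝔠 ∈ T, (L 𝔠).areaInv = ((Ideal.absNorm 𝔠 : ℕ) : ℂ) * A₀) (hA0 : A₀ ≠ 0)
    {η : HeckeCharacter K} {σ' : ℝ} (hη : ∀ x : ideleGroup K, ‖((η x : ℂˣ) : ℂ)‖ = ideleNorm x ^ σ')
    (h1 : 1 < σ') {j k : ℕ}
    (hval : ∀ v : HeightOneSpectrum (𝓞 K), ¬ modulusIdeal Tl el ≤ v.asIdeal →
      η.valueAtUniformizer v =
        (χ v)⁻¹ * (((Ideal.absNorm v.asIdeal : ℕ) : ℂ) ^ j * (lam.valueAtUniformizer v ^ (j + k))⁻¹))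
    (hram : ∀ v : HeightOneSpectrum (𝓞 K), ¬ η.IsUnramifiedAt v → v ∈ Tl)
    (hLη : LFunction.HasEntireContinuation (heckeLFunction η)) (hk : j + 3 ≤ k) :
    ∑ 𝔠 ∈ T, (idealPow K χ 𝔠)⁻¹ * (idealPow K (fun v ↦ lam.valueAtUniformizer v) 𝔠 ^ (j + k))⁻¹ *
        (L 𝔠).eisensteinKronecker j k Ω =
      ((k - 1)! : ℂ) * A₀ ^ j * conj Ω ^ j * (Ω ^ k)⁻¹ *
        (removedEulerFactorsAtZero η Tl * hLη.continuation 0) := by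
  have h𝔪0 : modulusIdeal Tl el ≠ ⊥ := modulusIdeal_ne_bot Tl el
  rw [sum_eisensteinKronecker_eq_rayClassLSeries_zero h2 h𝔪1 h𝔪0 hw
      (valueAtUniformizer_ne_zero_of_not_le lam _)
      (HasInfinityType.idealPow_span_mul_embedding_eq h2 w₀ hl hlmod) hχ hT hΩ L hL hA hA0 hk,
    ← rayClassLSeries_congr h𝔪0 hval 0,
    rayClassLSeries_zero_eq_removedEulerFactorsAtZero_mul_continuation_zero hη h1 h𝔪0
      (fun _ ↦ modulusIdeal_le_iff) hram hLη]


/-- ★★ **The 𝔞-TWISTED complex side of II.4.14 (38)→(39)→(36) at `j = 0`, `k ≥ 3`, idelic currency** (appended;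
composes `sum_twist_eisensteinE_eq_rayClassLSeries_zero` of `EisensteinNumbersPartialHeckeLTwist` — cell
`bsd-print-cf2`, seat `-w5` g14 — with the imprimitive value-at-zero dictionary): for the auxiliary ideal `𝔞 ≠ 0`
prime to `𝔪` (de Shalit's `μ_𝔞 = 12(σ_𝔞 − N𝔞)μ`),
`Σ_{𝔠∈T} χ̃(𝔠)⁻¹·φ̃(𝔠)^{−k}·(N𝔞·E_k(Ω, L 𝔠) − E_k(Ω, L(𝔞𝔠))) =
(k−1)!·Ω^{−k}·(N𝔞 − χ̃(𝔞)·φ̃(𝔞)^k)·∏_{w∈Tl}(1 − η(w))·L(η, 0)`, `L(η, 0) := hL.continuation 0`.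
[cite: deShalit1987, II.4.11 (29), II.4.14 (38)–(39) and (36)] -/
theorem sum_twist_eisensteinE_eq_removedEulerFactorsAtZero_mul_continuation (h2 : Module.finrank ℚ K = 2)
    (w₀ : InfinitePlace K) {lam : HeckeCharacter K} {Tl : Finset (HeightOneSpectrum (𝓞 K))}
    {el : HeightOneSpectrum (𝓞 K) → ℕ} (hl : lam.HasInfinityType (fun _ ↦ 1) (fun _ ↦ 0))
    (hlmod : IsModulus lam Tl el) (h𝔪1 : modulusIdeal Tl el ≠ ⊤)
    (hw : ∀ u : (𝓞 K)ˣ, (u : 𝓞 K) - 1 ∈ modulusIdeal Tl el → u = 1)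
    {χ : HeightOneSpectrum (𝓞 K) → ℂ} (hχ : IsRayClassCharacter (modulusIdeal Tl el) χ)
    {T : Finset (Ideal (𝓞 K))} (hT : IsRayClassReps (modulusIdeal Tl el) T)
    {𝔞 : Ideal (𝓞 K)} (h𝔞 : 𝔞 ≠ ⊥) (h𝔞cop : IsCoprime 𝔞 (modulusIdeal Tl el))
    {Ω : ℂ} (hΩ : Ω ≠ 0) (L : Ideal (𝓞 K) → PeriodPair)
    (hL : ∀ 𝔠 ∈ T, ∀ z : ℂ, z ∈ (L 𝔠).lattice ↔
      ∃ x ∈ ((modulusIdeal Tl el : FractionalIdeal (𝓞 K)⁰ K) / (𝔠 : FractionalIdeal (𝓞 K)⁰ K)),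
        z = Ω * w₀.embedding x)
    (hL𝔞 : ∀ 𝔠 ∈ T, ∀ z : ℂ, z ∈ (L (𝔞 * 𝔠)).lattice ↔
      ∃ x ∈ ((modulusIdeal Tl el : FractionalIdeal (𝓞 K)⁰ K) /
        ((𝔞 * 𝔠 : Ideal (𝓞 K)) : FractionalIdeal (𝓞 K)⁰ K)), z = Ω * w₀.embedding x)
    {η : HeckeCharacter K} {σ' : ℝ} (hη : ∀ x : ideleGroup K, ‖((η x : ℂˣ) : ℂ)‖ = ideleNorm x ^ σ')
    (h1 : 1 < σ') {k : ℕ}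
    (hval : ∀ v : HeightOneSpectrum (𝓞 K), ¬ modulusIdeal Tl el ≤ v.asIdeal →
      η.valueAtUniformizer v = (χ v)⁻¹ * (lam.valueAtUniformizer v ^ k)⁻¹)
    (hram : ∀ v : HeightOneSpectrum (𝓞 K), ¬ η.IsUnramifiedAt v → v ∈ Tl)
    (hLη : LFunction.HasEntireContinuation (heckeLFunction η)) (hk : 3 ≤ k) :
    ∑ 𝔠 ∈ T, (idealPow K χ 𝔠)⁻¹ * (idealPow K (fun v ↦ lam.valueAtUniformizer v) 𝔠 ^ k)⁻¹ *
        ((Ideal.absNorm 𝔞 : ℂ) * (L 𝔠).eisensteinE k Ω - (L (𝔞 * 𝔠)).eisensteinE k Ω) =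
      ((k - 1)! : ℂ) * (Ω ^ k)⁻¹ *
        ((Ideal.absNorm 𝔞 : ℂ) - idealPow K χ 𝔞 * idealPow K (fun v ↦ lam.valueAtUniformizer v) 𝔞 ^ k) *
        (removedEulerFactorsAtZero η Tl * hLη.continuation 0) := by
  have h𝔪0 : modulusIdeal Tl el ≠ ⊥ := modulusIdeal_ne_bot Tl el
  rw [sum_twist_eisensteinE_eq_rayClassLSeries_zero h𝔪1 h𝔪0 hw (valueAtUniformizer_ne_zero_of_not_le lam _)
      (HasInfinityType.idealPow_span_mul_embedding_eq h2 w₀ hl hlmod) hχ hT h𝔞 h𝔞cop hΩ L hL hL𝔞 hk,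
    ← rayClassLSeries_congr h𝔪0 hval 0,
    rayClassLSeries_zero_eq_removedEulerFactorsAtZero_mul_continuation_zero hη h1 h𝔪0
      (fun _ ↦ modulusIdeal_le_iff) hram hLη]

/-- ★★ **The 𝔞-TWISTED complex side of II.4.14 (39)–(42) ⇒ (36) at GENERAL `j` (`k ≥ j + 3`), idelic currency**
(appended; composes `sum_twist_eisensteinKronecker_eq_rayClassLSeries_zero` of
`EisensteinKroneckerNumbersClassSumTwist` with the imprimitive value-at-zero dictionary): for `𝔞 ≠ 0` prime to `𝔪`,
lattices `Λ_{L 𝔟} = Ω·σ(𝔪/𝔟)` with `A(L 𝔟) = N𝔟·A₀` for `𝔟 ∈ T ∪ 𝔞·T`,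
`Σ_{𝔠∈T} χ̃(𝔠)⁻¹·λ̃(𝔠)^{−(j+k)}·(N𝔞·E_{−j,k}(Ω, L 𝔠) − E_{−j,k}(Ω, L(𝔞𝔠))) =
(k−1)!·A₀^j·Ω̄^j·Ω^{−k}·(N𝔞 − χ̃(𝔞)·λ̃(𝔞)^{j+k})·∏_{w∈Tl}(1 − η(w))·L(η, 0)`, `L(η, 0) := hL.continuation 0`,
for any Hecke character `η` of weight `< −2` agreeing with `χ⁻¹N^jλ^{−(j+k)}` off `𝔪` (de Shalit's `ε⁻¹`,
`ε = χφ^kφ̄^{−j}`, `φ̄ = N/φ`). [cite: deShalit1987, II.4.11 (29), II.4.14 (36) and (39)–(42)] -/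
theorem sum_twist_eisensteinKronecker_eq_removedEulerFactorsAtZero_mul_continuation
    (h2 : Module.finrank ℚ K = 2)
    (w₀ : InfinitePlace K) {lam : HeckeCharacter K} {Tl : Finset (HeightOneSpectrum (𝓞 K))}
    {el : HeightOneSpectrum (𝓞 K) → ℕ} (hl : lam.HasInfinityType (fun _ ↦ 1) (fun _ ↦ 0))
    (hlmod : IsModulus lam Tl el) (h𝔪1 : modulusIdeal Tl el ≠ ⊤)
    (hw : ∀ u : (𝓞 K)ˣ, (u : 𝓞 K) - 1 ∈ modulusIdeal Tl el → u = 1)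
    {χ : HeightOneSpectrum (𝓞 K) → ℂ} (hχ : IsRayClassCharacter (modulusIdeal Tl el) χ)
    {T : Finset (Ideal (𝓞 K))} (hT : IsRayClassReps (modulusIdeal Tl el) T)
    {𝔞 : Ideal (𝓞 K)} (h𝔞 : 𝔞 ≠ ⊥) (h𝔞cop : IsCoprime 𝔞 (modulusIdeal Tl el))
    {Ω : ℂ} (hΩ : Ω ≠ 0) (L : Ideal (𝓞 K) → PeriodPair)
    (hL : ∀ 𝔠 ∈ T, ∀ z : ℂ, z ∈ (L 𝔠).lattice ↔
      ∃ x ∈ ((modulusIdeal Tl el : FractionalIdeal (𝓞 K)⁰ K) / (𝔠 : FractionalIdeal (𝓞 K)⁰ K)),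
        z = Ω * w₀.embedding x)
    (hL𝔞 : ∀ 𝔠 ∈ T, ∀ z : ℂ, z ∈ (L (𝔞 * 𝔠)).lattice ↔
      ∃ x ∈ ((modulusIdeal Tl el : FractionalIdeal (𝓞 K)⁰ K) /
        ((𝔞 * 𝔠 : Ideal (𝓞 K)) : FractionalIdeal (𝓞 K)⁰ K)), z = Ω * w₀.embedding x)
    {A₀ : ℂ} (hA : ∀ 𝔠 ∈ T, (L 𝔠).areaInv = ((Ideal.absNorm 𝔠 : ℕ) : ℂ) * A₀)
    (hA𝔞 : ∀ 𝔠 ∈ T, (L (𝔞 * 𝔠)).areaInv = ((Ideal.absNorm (𝔞 * 𝔠) : ℕ) : ℂ) * A₀) (hA0 : A₀ ≠ 0)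
    {η : HeckeCharacter K} {σ' : ℝ} (hη : ∀ x : ideleGroup K, ‖((η x : ℂˣ) : ℂ)‖ = ideleNorm x ^ σ')
    (h1 : 1 < σ') {j k : ℕ}
    (hval : ∀ v : HeightOneSpectrum (𝓞 K), ¬ modulusIdeal Tl el ≤ v.asIdeal →
      η.valueAtUniformizer v =
        (χ v)⁻¹ * (((Ideal.absNorm v.asIdeal : ℕ) : ℂ) ^ j * (lam.valueAtUniformizer v ^ (j + k))⁻¹))
    (hram : ∀ v : HeightOneSpectrum (𝓞 K), ¬ η.IsUnramifiedAt v → v ∈ Tl)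
    (hLη : LFunction.HasEntireContinuation (heckeLFunction η)) (hk : j + 3 ≤ k) :
    ∑ 𝔠 ∈ T, (idealPow K χ 𝔠)⁻¹ * (idealPow K (fun v ↦ lam.valueAtUniformizer v) 𝔠 ^ (j + k))⁻¹ *
        ((Ideal.absNorm 𝔞 : ℂ) * (L 𝔠).eisensteinKronecker j k Ω -
          (L (𝔞 * 𝔠)).eisensteinKronecker j k Ω) =
      ((k - 1)! : ℂ) * A₀ ^ j * conj Ω ^ j * (Ω ^ k)⁻¹ *
        ((Ideal.absNorm 𝔞 : ℂ) -
          idealPow K χ 𝔞 * idealPow K (fun v ↦ lam.valueAtUniformizer v) 𝔞 ^ (j + k)) *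
        (removedEulerFactorsAtZero η Tl * hLη.continuation 0) := by
  have h𝔪0 : modulusIdeal Tl el ≠ ⊥ := modulusIdeal_ne_bot Tl el
  rw [sum_twist_eisensteinKronecker_eq_rayClassLSeries_zero h2 h𝔪1 h𝔪0 hw
      (valueAtUniformizer_ne_zero_of_not_le lam _)
      (HasInfinityType.idealPow_span_mul_embedding_eq h2 w₀ hl hlmod) hχ hT h𝔞 h𝔞cop hΩ L hL hL𝔞
      hA hA𝔞 hA0 hk,
    ← rayClassLSeries_congr h𝔪0 hval 0,
    rayClassLSeries_zero_eq_removedEulerFactorsAtZero_mul_continuation_zero hη h1 h𝔪0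
      (fun _ ↦ modulusIdeal_le_iff) hram hLη]

end Literature.NumberTheory.EllipticCurves.DeShalit1987

end
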